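import Mathlib
import HarnessLib
import Summits.Parity.BatemanHorn.Theorems.IsogenyRedeiSplitBlockJacobiDigitReparametrisation

/-!
# Crux `SplitBlockJacobi` (stmt-Parity-11583, route `IsogenyRedei`), line `cofactor-root-discrepancy`:
# the pair-side Fubini identity (`stub_pairForm`)

For `θ ∈ (1/2, 1)` and `x ≥ 4`,
`J_θ(x) := Σ_{1 ≤ t ≤ x} Σ_{(Q,Q′) ∈ pf(t²+1)², x^θ < Q < Q′} (Q|Q′)
        = Σ_{(Q,Q′) ∈ P_θ(x)} (Q|Q′) · #{1 ≤ t ≤ x : QQ′ ∣ t²+1}`,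
where `P_θ(x)` is the FREE set of prime pairs `Q ≡ Q′ ≡ 1 (mod 4)`, `x^θ < Q < Q′`, `QQ′ ≤ x²+1`
(both coordinates `< x²+2`).  Pure finite combinatorics:

* `two_le_rpow_of_four_le`: `4 ≤ x`, `1/2 < θ` give `2 ≤ x^θ`, so every prime `Q > x^θ` is odd;
* `pairForm_filter_eq` (the key set identity, for each `1 ≤ t ≤ x`): the inner filter of `J` at `t`
  equals `P_θ(x).filter (QQ′ ∣ t²+1)` — an odd prime factor of `t²+1` is `≡ 1 (mod 4)`
  (tree: `DigitReparam.mod_four_eq_one_of_dvd`), two distinct primes dividing `t²+1` have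
  `QQ′ ∣ t²+1 ≤ x²+1`, and conversely `Q ∣ QQ′ ∣ t²+1 ≠ 0` puts `Q` in `pf(t²+1)`;
* `stub_pairForm`: rewrite the inner sums, write `card` as a sum of ones, and swap the two finite
  sums (`Finset.sum_comm'`).

The hypothesis `4 ≤ x` is genuinely used (at `x = 3` the pair `(2,5) ∣ 3²+1` lies in `J` but not in
`P_θ(x)`); `θ < 1` is only passed along.
-/

/- LOG (stub-worker, stub_pairForm):
  - proved: `two_le_rpow_of_four_le`, `pairForm_filter_eq`, `stub_pairForm` (all in this file);
  - left: nothing; no auxiliary landed files. -/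

noncomputable section

open Finset

namespace Summit.Parity.BatemanHorn.Cruxes.SplitBlockJacobi.CofactorRootDiscrepancy

open Summit.Parity.BatemanHorn.Cruxes.SplitBlockJacobi.SplitMassMiddlePrime
  (DigitReparam.mod_four_eq_one_of_dvd)

/-- For `4 ≤ x` and `1/2 < θ` we have `2 ≤ x^θ` (`2 = 4^{1/2} ≤ 4^θ ≤ x^θ`). [folklore] -/
theorem two_le_rpow_of_four_le {θ : ℝ} {x : ℕ} (hθ : 1 / 2 < θ) (hx : 4 ≤ x) :
    (2 : ℝ) ≤ (x : ℝ) ^ θ := by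
  have hx' : (4 : ℝ) ≤ (x : ℝ) := by exact_mod_cast hx
  calc (2 : ℝ) = (4 : ℝ) ^ (1 / 2 : ℝ) := by
        rw [show (4 : ℝ) = (2 : ℝ) ^ (2 : ℝ) by rw [Real.rpow_two]; norm_num,
          ← Real.rpow_mul (by norm_num : (0 : ℝ) ≤ 2)]
        norm_num
    _ ≤ (4 : ℝ) ^ θ := Real.rpow_le_rpow_of_exponent_le (by norm_num) hθ.le
    _ ≤ (x : ℝ) ^ θ := Real.rpow_le_rpow (by norm_num) hx' (by linarith)

/-- **Key set identity.** If `2 ≤ x^θ` and `1 ≤ t ≤ x`, the pairs `(Q, Q′)` of prime factors of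
`t²+1` with `x^θ < Q < Q′` are exactly the pairs of the free pair set
`{(Q,Q′) : Q, Q′ prime, ≡ 1 (mod 4), x^θ < Q < Q′, QQ′ ≤ x²+1, Q, Q′ < x²+2}` with `QQ′ ∣ t²+1`.
[folklore] -/
theorem pairForm_filter_eq {θ : ℝ} {x t : ℕ} (hx2 : (2 : ℝ) ≤ (x : ℝ) ^ θ)
    (ht : t ∈ Finset.Icc 1 x) :
    ((t ^ 2 + 1).primeFactors ×ˢ (t ^ 2 + 1).primeFactors).filter
        (fun q : ℕ × ℕ => (x : ℝ) ^ θ < (q.1 : ℝ) ∧ q.1 < q.2) =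
      ((Finset.range (x ^ 2 + 2) ×ˢ Finset.range (x ^ 2 + 2)).filter (fun q : ℕ × ℕ =>
          q.1.Prime ∧ q.2.Prime ∧ q.1 % 4 = 1 ∧ q.2 % 4 = 1 ∧ (x : ℝ) ^ θ < (q.1 : ℝ) ∧
            q.1 < q.2 ∧ q.1 * q.2 ≤ x ^ 2 + 1)).filter
        (fun q : ℕ × ℕ => q.1 * q.2 ∣ t ^ 2 + 1) := by
  have htx : t ≤ x := (Finset.mem_Icc.mp ht).2
  have ht2 : t ^ 2 + 1 ≤ x ^ 2 + 1 := Nat.add_le_add_right (Nat.pow_le_pow_left htx 2) 1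
  ext ⟨a, b⟩
  simp only [Finset.mem_filter, Finset.mem_product, Finset.mem_range, Nat.mem_primeFactors]
  constructor
  · rintro ⟨⟨⟨ha, had, -⟩, ⟨hb, hbd, -⟩⟩, hxa, hab⟩
    have ha2' : (2 : ℝ) < (a : ℝ) := lt_of_le_of_lt hx2 hxa
    have ha2 : 2 < a := by exact_mod_cast ha2'
    have hcop : Nat.Coprime a b := (Nat.coprime_primes ha hb).mpr hab.ne
    have hdvd : a * b ∣ t ^ 2 + 1 := hcop.mul_dvd_of_dvd_of_dvd had hbd
    have hle : a * b ≤ t ^ 2 + 1 := Nat.le_of_dvd (Nat.succ_pos _) hdvd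
    have hale : a ≤ a * b := Nat.le_mul_of_pos_right a hb.pos
    have hble : b ≤ a * b := Nat.le_mul_of_pos_left b ha.pos
    refine ⟨⟨⟨by omega, by omega⟩, ha, hb, ?_, ?_, hxa, hab, hle.trans ht2⟩, hdvd⟩
    · exact DigitReparam.mod_four_eq_one_of_dvd ha (by omega) had
    · exact DigitReparam.mod_four_eq_one_of_dvd hb (by omega) hbd
  · rintro ⟨⟨-, ha, hb, -, -, hxa, hab, -⟩, hdvd⟩
    exact ⟨⟨⟨ha, (dvd_mul_right a b).trans hdvd, Nat.succ_ne_zero _⟩,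
      ⟨hb, (dvd_mul_left b a).trans hdvd, Nat.succ_ne_zero _⟩⟩, hxa, hab⟩

/-- **`stub_pairForm`** (pair-side Fubini).  For `θ ∈ (1/2, 1)` and `x ≥ 4`:
`Σ_{1 ≤ t ≤ x} Σ_{(Q,Q′) ∈ pf(t²+1)², x^θ < Q < Q′} (Q|Q′)
  = Σ_{(Q,Q′) ∈ P_θ(x)} (Q|Q′) · #{1 ≤ t ≤ x : QQ′ ∣ t²+1}`,
`P_θ(x)` the free set of prime pairs `Q ≡ Q′ ≡ 1 (mod 4)`, `x^θ < Q < Q′`, `QQ′ ≤ x²+1`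
(coordinates `< x²+2`).  By `pairForm_filter_eq` termwise in `t`, `card` as a sum of ones, and
`Finset.sum_comm'`. [folklore] -/
theorem stub_pairForm :
    ∀ θ : ℝ, 1 / 2 < θ → θ < 1 → ∀ x : ℕ, 4 ≤ x →
      (∑ t ∈ Finset.Icc 1 x, ∑ q ∈ ((t ^ 2 + 1).primeFactors ×ˢ (t ^ 2 + 1).primeFactors).filter
          (fun q : ℕ × ℕ => (x : ℝ) ^ θ < (q.1 : ℝ) ∧ q.1 < q.2), (jacobiSym (q.1 : ℤ) q.2 : ℝ)) =
      ∑ q ∈ (Finset.range (x ^ 2 + 2) ×ˢ Finset.range (x ^ 2 + 2)).filter (fun q : ℕ × ℕ =>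
          q.1.Prime ∧ q.2.Prime ∧ q.1 % 4 = 1 ∧ q.2 % 4 = 1 ∧ (x : ℝ) ^ θ < (q.1 : ℝ) ∧ q.1 < q.2 ∧
            q.1 * q.2 ≤ x ^ 2 + 1),
        (jacobiSym (q.1 : ℤ) q.2 : ℝ) *
          ((((Finset.Icc 1 x).filter (fun t : ℕ => q.1 * q.2 ∣ t ^ 2 + 1)).card : ℕ) : ℝ) := by
  intro θ hθ _ x hx
  have hx2 : (2 : ℝ) ≤ (x : ℝ) ^ θ := two_le_rpow_of_four_le hθ hx
  set P : Finset (ℕ × ℕ) := (Finset.range (x ^ 2 + 2) ×ˢ Finset.range (x ^ 2 + 2)).filter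
      (fun q : ℕ × ℕ => q.1.Prime ∧ q.2.Prime ∧ q.1 % 4 = 1 ∧ q.2 % 4 = 1 ∧
        (x : ℝ) ^ θ < (q.1 : ℝ) ∧ q.1 < q.2 ∧ q.1 * q.2 ≤ x ^ 2 + 1) with hP
  have hL : ∀ t ∈ Finset.Icc 1 x,
      ∑ q ∈ ((t ^ 2 + 1).primeFactors ×ˢ (t ^ 2 + 1).primeFactors).filter
          (fun q : ℕ × ℕ => (x : ℝ) ^ θ < (q.1 : ℝ) ∧ q.1 < q.2), (jacobiSym (q.1 : ℤ) q.2 : ℝ) =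
        ∑ q ∈ P.filter (fun q : ℕ × ℕ => q.1 * q.2 ∣ t ^ 2 + 1),
          (jacobiSym (q.1 : ℤ) q.2 : ℝ) := fun t ht => by
    rw [pairForm_filter_eq hx2 ht]
  have hR : ∀ q ∈ P,
      (jacobiSym (q.1 : ℤ) q.2 : ℝ) *
          ((((Finset.Icc 1 x).filter (fun t : ℕ => q.1 * q.2 ∣ t ^ 2 + 1)).card : ℕ) : ℝ) =
        ∑ _t ∈ (Finset.Icc 1 x).filter (fun t : ℕ => q.1 * q.2 ∣ t ^ 2 + 1),
          (jacobiSym (q.1 : ℤ) q.2 : ℝ) := fun q _ => by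
    rw [Finset.sum_const, nsmul_eq_mul, mul_comm]
  rw [Finset.sum_congr rfl hL, Finset.sum_congr rfl hR]
  refine Finset.sum_comm' fun t q => ?_
  simp only [Finset.mem_filter]
  tauto

end Summit.Parity.BatemanHorn.Cruxes.SplitBlockJacobi.CofactorRootDiscrepancy

end
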